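import Mathlib
import HarnessLib
import HarnessLib.Audit
import Summits.NavierStokesRegularity.Statement
import Literature.Analysis.FluidPDE.ClassicalSolution
import Literature.Analysis.FluidPDE.LerayHopf
import Literature.Analysis.FluidPDE.NSWave0
import Literature.Analysis.FluidPDE.NormalisedPressure
import HarnessLib.Audit.Status.Attr

/-!
Route: LevelSetModeration

DORMANT since 2026-08-25T10:45:33Z (reconciler: no traction for 7.6 d (last activity item-evidence-added at 2026-08-17T19:12:04Z); parked, not closed — `ledger route dormant route-NavierStokesRegularity-LevelSetModeration --off` to reac) — unstaffed, not closed; items shared with open routes are served there. `ledger route dormant <id> --off` reactivates.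

# Route LevelSetModeration — De Giorgi level sets of the speed beat scaling iff the moderated
pressure work on high-speed sets is sub-generic

It suffices to show X = HighSpeedPressureWork ∧ LevelSetClosure (lens 3.17 `controlling-quantity`,
CLOSING-ITERATION shape; no card —
an original line of this lens seat). Controlling quantity Φ: the De Giorgi LEVEL-SET ENERGY OF THE
SPEED s = |u| of a classical
Leray–Hopf solution on EuclideanSpace ℝ (Fin 3), U(c) = sup_t ∫(s−c)₊² dx + 2ν ∫∫ 1_{s>c} |∇s|²
(Vasseur2007's level sets, global and for the speed). Its
evolution is exact: d/dt ∫(s−c)₊²/2 + ν∫d_c² = −∫ (1−c/s)₊ u·∇p̃ — the PRESSURE WORK ON THE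
HIGH-SPEED SET, and any function Φ(t,s) may
be subtracted from p̃ there (moderation identity). HighSpeedPressureWork (crux 2, the improvement
step): above twice the initial maximum
speed this one-sided pairing is bounded by (F·M^m·|{s>c}|)^½ · (level-set dissipation)^½ with some m
< 10/3 (generic bookkeeping gives
exactly m = 4). LevelSetClosure (crux 3, `Phi_controls`): such a bound closes the De Giorgi
iteration (Chebyshev gain 5/3 on the parabolic
Sobolev scale L^{10/3}) and gives an L^∞ bound on [0,T), hence continuation and Clay (A) by landed
theorems.
Lean: `HighSpeedPressureWork ∧ LevelSetClosure`

## Assembly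
Pure logic, cone-clean since rev 1 (certified `closes`, standard axioms; no Theorems / proof-module
import): given ν, T and a classical
Leray–Hopf u from a rapidly decaying datum, rapid decay gives B₀ = C₀₀ with |u₀| ≤ B₀ and E₀ =
∫|u₀|²; HighSpeedPressureWork supplies m, F
and the pairing bound for M ≥ 2B₀; LevelSetClosure (with Λ = F(E₀,B₀), M₀ = 2B₀+2) gives a bound on
[0,T) — so every classical Leray–Hopf
solution from rapidly decaying data is bounded on its interval; the support item BoundedToClay
(bounded ⇒ Clay (A): continuation of bounded
Leray–Hopf solutions, RobinsonRodrigoSadowski2016 Thm 8.17, composed with the shared local Clay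
theory NoBlowup → (A); PROVED in tree as
`hasSmoothExtensionPast_of_bounded_holds` + `typeICertificateLadder_noBlowupToClay_proof`, kept as
an ITEM so that this file imports only
definition modules) turns that into Clay (A).

Rationale: WHY THIS LINE. Vasseur2007 (NoDEA, Conj. 14 + Appendix, pp. 5, 24, 29 read) proved that De Giorgi
truncation of |u| closes for Navier–Stokes with
exponent β_p > 1 in every term and β > 3/2 in all terms but ONE — the local pressure term not in
divergence form (exponent < 4/3) — and that
β > 3/2 would give full regularity of suitable weak solutions. This route (i) runs the truncation
GLOBALLY on EuclideanSpace ℝ (Fin 3) for Clay solutions with the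
normalised pressure p̃ = R_iR_j(u_iu_j) (no cut-offs, no harmonic pressure, no collar terms: the
identity for (s−c)₊² is exact), (ii) shows by
dimension count that 4/3 = 1/2 + 5/6 is forced for ANY term pairing the pressure with the velocity
gradient carried by div((1−c/s)₊u) — so
β > 3/2 is equivalent to ONE statement: the pressure work −∫∫(1−c/s)₊u·∇p̃ on speed super-level sets
grows like M^m|A_c| with m < 10/3 instead
of the generic 4 — and (iii) imports Tran–Yu pressure moderation (TranYu2015, TranYu2016,
TranYuDritschel2021: velocity–pressure correlation
on high-velocity regions, there in the L^q-energy framework and qualitative) as the mechanism for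
the missing 2/3 of a power: only the
conditional fluctuation of p̃ given (t,|u|) enters, it vanishes identically for
Beltrami/steady-potential structure and is cyclostrophically
small in vortex cores. Imported areas: De Giorgi–Nash–Moser regularity (elliptic/parabolic PDE),
turbulence phenomenology of velocity–pressure
correlation. No open route uses level-set truncation of the velocity; BernoulliDeceleration /
HiddenConvexityPressureFloor use sup-type
one-sided head or pressure-Hessian bounds with Seregin–Šverák 2002, not an L²/pairing law feeding an
iteration.

RANKED CRUXES. #2 HighSpeedPressureWork (crux) — for every ν, T > 0 there are m < 10/3 and a modulus
F such that every classical Leray–Hopf solution on EuclideanSpace ℝ (Fin 3)×[0,T) from a rapidly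
decaying datum with ∫|u₀|² ≤ E₀, |u₀| ≤ B₀ satisfies, for all M ≥ 2B₀, c ∈ [M/2,M], t < T:
−∫₀ᵗ∫(1−c/|u|)₊ u·∇p̃ ≤ (F(E₀,B₀) M^m |{|u|>c}|)^½ (∫₀ᵀ∫1_{|u|>c}|∇|u||²)^½ (improvement step of the
level-set iteration; moderation by any Φ(t,|u|) is free). [difficulty: open-problem] (why it might
fail: A 2/3-power gain over the dimensional rate m=4: false if NS can sustain pressure-driven
acceleration of already-fastest fluid on sets of near-Chebyshev-maximal measure (a focusing
jet/collapse cascade); kinematically (arbitrary div-free fields) m=4 is sharp.) [Vasseur2007,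
TranYu2016, TranYuDritschel2021, TranYu2015, CaffarelliVasseur2010,
Literature.Barriers.NavierStokesRegularity.EnergySupercriticality]
#3 LevelSetClosure (crux) — (Phi_controls) if a classical Leray–Hopf solution from a rapidly
decaying datum with |u₀| ≤ M₀/2 obeys the pressure-work bound of crux 2 with some Λ and m < 10/3 for
all M ≥ M₀, c ∈ [M/2,M], then u is bounded on [0,T) (De Giorgi iteration for the speed: level-set
energy inequality + Cauchy–Schwarz give U(c_k) ≤ 4ΛM^m|A_{c_k}|/ν, Chebyshev + Gagliardo–Nirenberg
give |A_{c_k}| ≤ C_S 2^{10k/3} M^{−10/3} ν^{−1} U(c_{k−1})^{5/3}, and M^{m−10/3} → 0 starts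
Vasseur's Lemma 4). [difficulty: L] (why it might fail: Needs the global level-set inequality for
the SPEED with p̃ (decay of u, ∇u, ∇p̃ at infinity for classical LH solutions; ∇p = ∇p̃) and GNS on
EuclideanSpace ℝ (Fin 3); a classical LH solution with slowly decaying pressure gradient outside the
Tao class would break the integration by parts.) [Vasseur2007, CaffarelliKohnNirenberg1982,
RobinsonRodrigoSadowski2016, Tao2013LocalisationCompactness]
#9 LevelSetEnergyInequality (support) — Vasseur's Lemma 11 globalised for the speed: for a classical
Leray–Hopf solution from a rapidly decaying datum and a level c above the initial speed maximum,
∫(|u(t)|−c)₊² + 2ν∫₀ᵗ∫1_{|u|>c}|∇|u||² ≤ −2∫₀ᵗ∫(1−c/|u|)₊ u·∇p̃ (dot NS with (1−c/|u|)₊u; transport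
integrates to zero; |∇|u|| ≤ |∇u|). [difficulty: M] [Vasseur2007, RobinsonRodrigoSadowski2016]
#9 ModerationIdentity (support) — for a C¹ divergence-free field with bounded super-level set
{|u|>c} and continuous g: ∫ 1_{|u|>c} g(|u|) (c/|u|²) (u·∇|u|) dx = 0 (= ∫ u·∇G(|u|)); hence any
Φ(t,|u|) can be subtracted from p̃ in the pressure-work pairing (Tran–Yu moderation in De Giorgi
form). [difficulty: provable-now] [TranYu2016, TranYuDritschel2021]
#9 IterationLemma (support) — Vasseur's nonlinear iteration lemma with explicit threshold: 0 ≤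
W_{k+1} ≤ C^{k+1} W_k^β, C > 1, β > 1, W_0 ≤ C^{−β/(β−1)²} ⇒ W_k → 0 (PROVED sorry-free in the
planner folder, bc/IterationLemma_special.lean, rc 0). [difficulty: provable-now] [Vasseur2007]
#9 BoundedToClay (support; cone repair, rev 1) — if every classical solution of unforced NS on
ℝ³×[0,T) that is Leray–Hopf on [0,T] from a rapidly decaying datum is bounded on [0,T)×ℝ³ (every ν,
T > 0), then Clay (A) holds: the bounded-continuation principle (RobinsonRodrigoSadowski2016 Thm
8.17, Prodi–Serrin class L²_t L^∞_x; Leray 1934) composed with the shared local Clay theory NoBlowup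
→ (A) (stmt-0055). PROVED in tree (planner folder bc/BoundedToClay_provable.lean: `fun h =>
typeICertificateLadder_noBlowupToClay_proof (fun ν T hν hT u p hcl hLH hdec =>
hasSmoothExtensionPast_of_bounded_holds hν hT hcl hLH (h ν T hν hT u p hcl hLH hdec))`, rc 0,
standard axioms) but only inside cone-dirty modules — see CONE HYGIENE under NUMBERS; leave it open
until the cruxes close. [difficulty: provable-now] [RobinsonRodrigoSadowski2016, Leray1934,
Fefferman2000, KNSS2009]

TWO-LAYER PLAN. HighSpeedPressureWork ⇐ ModeratedCauchySchwarz → HeadDecorrelation →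
HighSpeedPressureWork (birth skeleton bc/HighSpeedPressureWork_birth.lean,
rc 0): the pairing is bounded by ‖(p̃ − Φ(t,|u|))1_{|u|>c}‖_L² · (dissipation)^½ for every
measurable moderator (M), and the load-bearing
child is the L² decorrelation law ‖(p̃ − Φ)1_{|u|>c}‖²_L² ≤ F M^m |{|u|>c}|, m < 10/3 (XL); a
further regime split of HeadDecorrelation by
the local Okubo–Weiss sign (rotation-dominated components: cyclostrophic balance; strain-dominated
components: Bernoulli along streamlines,
∇H = u×ω − ∂_t u + νΔu) is foreseen but not filed. LevelSetClosure ⇐ LevelSetRecursion →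
IterationLemma → ZeroExcessBounded → LevelSetClosure
(birth skeleton bc/LevelSetClosure_birth.lean, rc 0; IterationLemma already proved).

KILL CRITERIA. A refutation of HighSpeedPressureWork (a family of classical LH solutions with common
(ν,T,E₀,B₀) along which the pressure work on
{|u|>c}, c ≥ B₀, exceeds every F·M^m|A_c| with m < 10/3 — e.g. a provable focusing configuration
with pressure-driven acceleration of the
fastest fluid at the Chebyshev-maximal measure) closes the route `refuted:HighSpeedPressureWork` and
is filed as the barrier note
"moderation does not beat 10/3". A refutation of LevelSetClosure can only be a misstatement
(decay/normalisation clause) ⇒ restate. NoBlowup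
or NoTypeII∧NoTypeI proved elsewhere moots the route; a certified blow-up (CertifiedBlowup, Hou)
kills it with every positive route.

NOT DECOMPOSED YET. The decorrelation law itself (child HeadDecorrelation) and its regime split; the
choice of moderator class (functions of (t,|u|) suffice
for the identity; moderators constant along streamlines / per connected component of {|u|>c} are
admissible and stronger — left to the
prover); constants C_S, the ε-free bookkeeping of ν, and the Tao-class decay facts needed by
LevelSetEnergyInequality (layer-2 of crux 3).

CHEAPEST FALSIFIER. (1) Exact solutions: Beltrami/ABC give p̃ = const − |u|²/2 so the pairing ≡ 0
(consistent); a refuter should try swirling jets (p̃ a function of r, not |u|), colliding vortex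
rings, a converging axisymmetric jet — any classical family with common (ν,T,E₀,B₀) whose pressure
work on {|u|>c}, c ≥ B₀, outgrows every F·M^m|A_c|, m < 10/3. (2) RUN (kit j021790, pre-registered,
N=96, 5 decaying periodic flows; details in § Numbers and NOTES.md): the perturbed ABC flow
overshoots to 1.51B₀; on its levels c ∈ [B₀,1.3B₀] the cancellation index κ = W₊/W_abs rises 0.18 →
0.39 (TG 0.47 at 0.99B₀, rings 0.27), the moderation residual ρ stays ≈ 0.9 except at the extreme
levels (0.64; TG 0.05), and W₊²/(|A_c|D_c) rises steeply through the PDF shoulder (ladder fit m_eff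
5.6; rings 5.0) but flattens on top (local slope 2.6 < 10/3 over [B₀,1.3B₀]). Pre-registered
verdict: INCONCLUSIVE — the fastest fluid is pressure-accelerated on balance (κ_top 0.2–0.5), so the
law cannot come from sign cancellation alone; a single-flow ladder does not measure the crux
exponent (thresholds M at fixed data modulus). Part 2: j021926 (ring collision, close/orthogonal
tubes, Re 1000, N=128).

NUMBERS. De Giorgi threshold: β > 3/2 ⇔ m < 10/3 (parabolic Chebyshev on L^{10/3}: |{|u|>c_k}| ≤
2^{10k/3}(M/2)^{−10/3}‖(|u|−c_{k−1})₊‖^{10/3}_{10/3} ≤ C M^{−10/3}ν^{−1}U^{5/3});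
Vasseur2007: transport 5/3, nonlocal pressure 5/3(1−1/p), local div-form pressure 5/3, local non-div
pressure < 4/3 (p. 24); generic
pairing bookkeeping 4/3 = 1/2 (gradient) + 5/6 (level-set support in L²) ⇔ m = 4; dimensional
identity: with ν the only other scale a
closing law U_k ≤ C M^a ν^b U_{k−1}^β forces β = 4/3 — the modulus F(E₀,B₀) (or the window) is where
the extra scale must enter.
Compute (j021790): level-ladder fits m_eff = −1.5 (TG, 13 levels, ratio non-monotone), 5.0 (rings,
11), 5.6 (perturbed ABC, 19; overshoot to 1.51B₀; local slope 2.6 over [B₀,1.3B₀]); κ_top ∈ [0.27,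
0.47]; ρ_top ∈ [0.05, 0.64]; items at open: 6. After the cone repair (rev 1, 2026-08-17): 7 items —
2 cruxes (HighSpeedPressureWork 2,
LevelSetClosure 3), 4 supports (LevelSetEnergyInequality, ModerationIdentity, IterationLemma,
BoundedToClay), Assembly (restated to mirror `closes`).
CONE HYGIENE (for provers; priority guardrail `blocked-by-cone`): at open the file imported
Literature.Analysis.FluidPDE.KNSSTypeIIHolds and
Theorems.TypeICertificateLadderNoBlowupToClay for the two landed theorems the old `closes` used;
their module closure (666 project modules) carries
26 unproved NAMED FACTS (census; planner estimate 29: Axisymmetric.{chen_hou_blowup,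
elgindi_euler_blowup}, PartialRegularity.{TypeISingularityExists,
NontrivialTypeIAncientExists, tao_quantitative_ess, tao_L3_blowup_rate},
LocalTypeI.{LocalTypeISingularityExists, NontrivialMildAncientTypeIExists,
AlbrittonBarkerTypeICharacterization}, NSLerayHopf.{LerayHopfNonUniqueness,
EnergyClassNonUniqueness, albritton_brue_colombo}, MildSolutions.RusinSverakQuestion,
GKPCriticalElements.gkp_*, CriticalRegularity.{gkp,albritton}_besov_blowup, ESSBackwardUniquenessC1,
LocalLerayExistence, NSCriticalClosureBesov,
MildSolution.{IsMildNSSolutionBetween.trans, IsMildNSSolutionOn.isWeakNSSolutionOn},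
SelfSimilar.IsMildNSSolutionBetween.nsRescale,
Vorticity.IsVorticitySolutionOn.exists_pressure, BesovDifference.MemBoundedHolder.memBesovSup,
SymmetricPMap.IsEssentiallySelfAdjoint.isSymmetric) — NONE of
them in the constant cone of `closes` (gate: 0 unproved in 38 constants), several of them OPEN
PROBLEMS that no provefact seat can discharge. Since rev 1 the
file imports only the definition modules ClassicalSolution, LerayHopf, NSWave0, NormalisedPressure
(module closure 16 project modules; every named fact in it
has a `_holds` discharge in a Proofs module). A Theorems file proving an item of this route must NOT
import Theorems.TypeICertificateLadderNoBlowupToClay /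
Theorems.NoBlowupToClay / Theses.TypeICertificateLadder /
Literature.Analysis.FluidPDE.KNSSTypeIIHolds or the proof modules behind them, because the gate's
`_holds` link imports the proving module into this file and re-blocks the route; in particular
BoundedToClay (certain, proved in tree) stays OPEN until
HighSpeedPressureWork / LevelSetClosure close or a cone-clean Clay-bridge module exists (librarian
split of the rider facts, or their discharge). needs-fact: none.

DEFINITION REQUESTS. None needed for the items (all inline over IsClassicalNSSolutionOn,
IsLerayHopfOn, HasRapidSpatialDecay, normalisedPressure, fderiv,
lintegral/volume). Documentation defs `levelSetDissipation`, `levelSetVolume`, `pressureWork` sit in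
the planner's Sketch.lean; a
`Literature/Analysis/FluidPDE` notion `levelSetSpeedEnergy` may be requested once crux 3 is claimed.

Novelty: Searches (2026-08-17): corpus known_functionals_lit.json (2 hybrid queries, 29 strong hits:
energy/enstrophy/Lyapunov classics only);
`lit search --source crossref "Vasseur new proof partial regularity Navier-Stokes"` (8; Vasseur2007
read in full, 31 pp.); `lit search
--source crossref "Tran Yu pressure moderation Navier-Stokes"` (11: TranYu2015/2016/2017,
TranYuDritschel2021 — JFM 2021 read in full;
Nonlinearity 2016 paywalled, acq-01585); `lit search --hybrid "De Giorgi level set truncation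
Navier-Stokes pressure exponent full
regularity"` (10 books, none combining); `lit search --source zbmath "Vasseur De Giorgi
Navier-Stokes"` (7: CaffarelliVasseur2010,
ChoiVasseur2014, arXiv:0901.4359, MLM4 lectures); `lit search --source crossref --year-from 2015 "De
Giorgi method Navier-Stokes level set
energy pressure"` (12, none relevant); `lit galaxy search --star all` ×3 (0 substring hits); `lit
frontier NavierStokesRegularity --since
2023` (15; none on truncation); `lit bridges --cross any`; grep of 71 Theses + 20 Ideas for De
Giorgi/Vasseur/truncation (only proof-idea
mentions; card linear-liouville-drifted-stokes = De Giorgi for a LINEAR drifted Stokes Liouville,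
different object).
Nearest prior art found: Vasseur2007 Conj. 14 (β > 3/2 ⇒ regularity; local, cut-offs, no moderation,
deficit located in the local non-div
pressure term) and TranYuDritschel2021 / TranYu2016 (pressure moderation p → p + f g(|u|), u·∇f = 0,
velocity–pressure correlation
criteria in the L^q framework, qu  [refs: 0901.4359, Vasseur2007, TranYu2015, TranYuDritschel2021, CaffarelliVasseur2010, ChoiVasseur2014, TranYu2016]

Barriers (technique_class: de-giorgi-level-sets, pressure-moderation): - technique_class: de-giorgi-level-sets, pressure-moderation
- Literature.Barriers.NavierStokesRegularity.EnergySupercriticality: it does not evade it —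
HighSpeedPressureWork IS a 2/3-power gain over the dimensional rate (the barrier's dimension count
is reproduced exactly: 4/3 = 1/2+5/6, and with ν alone β = 4/3 is the only consistent exponent); the
bet is that conditioning the pressure on the speed (level sets "add a scale", Vasseur2007 p. 4)
removes the |u|⁴ mass of p̃² on high-speed sets through velocity–pressure correlation, a structure
invisible to scaling; the extra scale enters through the data modulus F(E₀,B₀).
- Literature.Barriers.NavierStokesRegularity.TaoAveragedBlowup: evaded by construction — the
level-set identity uses the pointwise transport cancellation (u·∇u)·û(1−c/s)₊ = u·∇K(s), the exact
algebra p̃ = R_iR_j(u_iu_j) and the moderation identity ∫Φ(s)div((1−c/s)₊u) = 0; an averaged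
bilinear form B̃ has no pointwise speed, no Bernoulli/cyclostrophic relation between its "pressure"
and |u|, so the argument cannot even be stated for Tao's class (it distinguishes B from B̃ as Tao
demands).
- Literature.Barriers.NavierStokesRegularity.NavierStokesInequalitySingularSolution: Scheffer's
blow-up solutions of the Navier–Stokes INEQUALITY satisfy the local energy inequality but not the
equation; the level-set inequality for the speed needs the momentum EQUATION dotted with the bounded
multiplier (1−c/s)₊u (Vasseur's (12)), unavailable in Scheffer's class — the line si

History (route lifecycle, newest last):
- 2026-08-17T02:42:45Z · rev 1: restated Assembly (stmt-NavierStokesRegularity-18154) — cone repair (route-repair planner, 2026-08-17): dropped imports Literature.Analysis.FluidPDE.KNSSTypeIIHolds + Summits…Theorems.TypeICertificateLadderNoBlowupTo (planner-rrepair-NavierStokesRegularity-LevelSe-cd1791d8-0)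
- 2026-08-25T10:45:33Z · DORMANT — reconciler: no traction for 7.6 d (last activity item-evidence-added at 2026-08-17T19:12:04Z); parked, not closed — `ledger route dormant route-NavierStokesRegu (operator:999:1348742)

sub-problem: NavierStokesRegularity · status: dormant · opened planner-plan-lens3-NavierStokesRegularity-control-0 2026-08-17T02:21:58Z · rev 3 · ledger route-NavierStokesRegularity-LevelSetModeration
GENERATED by the gate from the ledger (D-0016/17). Provers cite these decls: `theorem foo : Summit.NavierStokesRegularity.NavierStokesRegularity.Theses.LevelSetModeration.<Decl> := …` in Summits/NavierStokesRegularity/NavierStokesRegularity/Theorems/<Name>.lean.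
-/

namespace Summit.NavierStokesRegularity.NavierStokesRegularity.Theses.LevelSetModeration

open scoped BigOperators Topology Manifold Classical MeasureTheory ProbabilityTheory Matrix InnerProductSpace ComplexConjugate ContinuousMap
open Filter Set Function TopologicalSpace MeasureTheory

attribute [summit_statement] _root_.NavierStokesRegularity

open Literature.NS

/-- item stmt-NavierStokesRegularity-18149 · crux · rank 2 · open · by planner
why it might fail: A 2/3-power gain over the dimensional rate m=4: false if NS can sustain pressure-driven acceleration of already-fastest fluid on sets of near-Chebyshev-maximal measure (a focusing jet/collapse cascade); kinematically (arbitrary div-free fields) m=4 is sharp.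
sources: Vasseur2007, TranYu2016, TranYuDritschel2021, TranYu2015, CaffarelliVasseur2010, Literature.Barriers.NavierStokesRegularity.EnergySupercriticality
[crux] for every ν, T > 0 there are m < 10/3 and a modulus F such that every classical Leray–Hopf
solution on EuclideanSpace ℝ (Fin 3)×[0,T) from a rapidly decaying datum with ∫|u₀|² ≤ E₀, |u₀| ≤ B₀
satisfies, for all M ≥ 2B₀, c ∈ [M/2,M], t < T: −∫₀ᵗ∫(1−c/|u|)₊ u·∇p̃ ≤ (F(E₀,B₀) M^m |{|u|>c}|)^½
(∫₀ᵀ∫1_{|u|>c}|∇|u||²)^½ (improvement step of the level-set iteration; moderation by any Φ(t,|u|) is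
free). [difficulty: open-problem] -/
@[route_item "route-NavierStokesRegularity-LevelSetModeration", crux]
def HighSpeedPressureWork : Prop :=
  ∀ (ν T : ℝ), 0 < ν → 0 < T → ∃ m : ℝ, m < 10 / 3 ∧ ∃ F : ℝ → ℝ → ℝ, ∀ (u : ℝ → EuclideanSpace ℝ (Fin 3) → EuclideanSpace ℝ (Fin 3)) (p : ℝ → EuclideanSpace ℝ (Fin 3) → ℝ), Literature.Analysis.FluidPDE.IsClassicalNSSolutionOn (Set.Ico 0 T) ν 0 u p → Literature.Analysis.FluidPDE.IsLerayHopfOn T ν 0 (u 0) u → Literature.Analysis.FluidPDE.HasRapidSpatialDecay (u 0) → ∀ (E₀ B₀ : ℝ), (∫ x, ‖u 0 x‖ ^ 2) ≤ E₀ → (∀ x, ‖u 0 x‖ ≤ B₀) → ∀ (M c t : ℝ), 2 * B₀ ≤ M → M / 2 ≤ c → c ≤ M → 0 < c → t ∈ Set.Ico 0 T → -(∫ τ in Set.Ioo 0 t, ∫ x, max (1 - c / ‖u τ x‖) 0 * (fderiv ℝ (Literature.Analysis.FluidPDE.normalisedPressure (u τ)) x (u τ x))) ≤ Real.sqrt (F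 E₀ B₀ * M ^ m * (∫⁻ τ in Set.Ioo 0 T, volume {x | c < ‖u τ x‖}).toReal) * Real.sqrt ((∫⁻ τ in Set.Ioo 0 T, ∫⁻ x, Set.indicator {x | c < ‖u τ x‖} (fun x => ENNReal.ofReal (‖fderiv ℝ (fun y => ‖u τ y‖) x‖ ^ 2)) x).toReal)

/-- item stmt-NavierStokesRegularity-18150 · crux · rank 3 · closed · proved by Summit.NavierStokesRegularity.NavierStokesRegularity.Theorems.levelSetClosure_proof @ 3ae9529da11a (prover) · by planner
why it might fail: Needs the global level-set inequality for the SPEED with p̃ (decay of u, ∇u, ∇p̃ at infinity for classical LH solutions; ∇p = ∇p̃) and GNS on EuclideanSpace ℝ (Fin 3); a classical LH solution with slowly decaying pressure gradient outside the Tao class would break the integration by parts.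
sources: Vasseur2007, CaffarelliKohnNirenberg1982, RobinsonRodrigoSadowski2016, Tao2013LocalisationCompactness
[crux] (Phi_controls) if a classical Leray–Hopf solution from a rapidly decaying datum with |u₀| ≤
M₀/2 obeys the pressure-work bound of crux 2 with some Λ and m < 10/3 for all M ≥ M₀, c ∈ [M/2,M],
then u is bounded on [0,T) (De Giorgi iteration for the speed: level-set energy inequality +
Cauchy–Schwarz give U(c_k) ≤ 4ΛM^m|A_{c_k}|/ν, Chebyshev + Gagliardo–Nirenberg give |A_{c_k}| ≤ C_S
2^{10k/3} M^{−10/3} ν^{−1} U(c_{k−1})^{5/3}, and M^{m−10/3} → 0 starts Vasseur's Lemma 4).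
[difficulty: L] -/
@[route_item "route-NavierStokesRegularity-LevelSetModeration", crux]
def LevelSetClosure : Prop :=
  ∀ (ν T : ℝ), 0 < ν → 0 < T → ∀ (u : ℝ → EuclideanSpace ℝ (Fin 3) → EuclideanSpace ℝ (Fin 3)) (p : ℝ → EuclideanSpace ℝ (Fin 3) → ℝ), Literature.Analysis.FluidPDE.IsClassicalNSSolutionOn (Set.Ico 0 T) ν 0 u p → Literature.Analysis.FluidPDE.IsLerayHopfOn T ν 0 (u 0) u → Literature.Analysis.FluidPDE.HasRapidSpatialDecay (u 0) → ∀ (m Λ M₀ : ℝ), m < 10 / 3 → 0 < M₀ → (∀ x, ‖u 0 x‖ ≤ M₀ / 2) → (∀ (M c t : ℝ), M₀ ≤ M → M / 2 ≤ c → c ≤ M → 0 < c → t ∈ Set.Ico 0 T → -(∫ τ in Set.Ioo 0 t, ∫ x, max (1 - c / ‖u τ x‖) 0 * (fderiv ℝ (Literature.Analysis.FluidPDE.normalisedPressure (u τ)) x (u τ x))) ≤ Real.sqrt (Λ * M ^ m * (∫⁻ τ in Set.Ioo 0 T, volume {x | c < ‖u τ x‖}).toReal) * Real.sqrt ((∫⁻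 τ in Set.Ioo 0 T, ∫⁻ x, Set.indicator {x | c < ‖u τ x‖} (fun x => ENNReal.ofReal (‖fderiv ℝ (fun y => ‖u τ y‖) x‖ ^ 2)) x).toReal)) → ∃ B : ℝ, ∀ t ∈ Set.Ico 0 T, ∀ x, ‖u t x‖ ≤ B

/-- item stmt-NavierStokesRegularity-18151 · support · rank 9 · closed · proved by Summit.NavierStokesRegularity.NavierStokesRegularity.Theorems.levelSetModeration_levelSetEnergyInequality_proof @ ebe20d31c656 (prover) · by planner
sources: Vasseur2007, RobinsonRodrigoSadowski2016
[support] Vasseur's Lemma 11 globalised for the speed: for a classical Leray–Hopf solution from a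
rapidly decaying datum and a level c above the initial speed maximum, ∫(|u(t)|−c)₊² +
2ν∫₀ᵗ∫1_{|u|>c}|∇|u||² ≤ −2∫₀ᵗ∫(1−c/|u|)₊ u·∇p̃ (dot NS with (1−c/|u|)₊u; transport integrates to
zero; |∇|u|| ≤ |∇u|). [difficulty: M] -/
@[route_item "route-NavierStokesRegularity-LevelSetModeration"]
def LevelSetEnergyInequality : Prop :=
  ∀ (ν T : ℝ), 0 < ν → 0 < T → ∀ (u : ℝ → EuclideanSpace ℝ (Fin 3) → EuclideanSpace ℝ (Fin 3)) (p : ℝ → EuclideanSpace ℝ (Fin 3) → ℝ), Literature.Analysis.FluidPDE.IsClassicalNSSolutionOn (Set.Ico 0 T) ν 0 u p → Literature.Analysis.FluidPDE.IsLerayHopfOn T ν 0 (u 0) u → Literature.Analysis.FluidPDE.HasRapidSpatialDecay (u 0) → ∀ (c : ℝ), 0 < c → (∀ x, ‖u 0 x‖ ≤ c) → ∀ t ∈ Set.Ico 0 T, (∫ x, (max (‖u t x‖ - c) 0) ^ 2) + 2 * ν * (∫⁻ τ in Set.Ioo 0 t, ∫⁻ x, Set.indicator {x | c < ‖u τ x‖}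 (fun x => ENNReal.ofReal (‖fderiv ℝ (fun y => ‖u τ y‖) x‖ ^ 2)) x).toReal ≤ -(2 * ∫ τ in Set.Ioo 0 t, ∫ x, max (1 - c / ‖u τ x‖) 0 * (fderiv ℝ (Literature.Analysis.FluidPDE.normalisedPressure (u τ)) x (u τ x)))

/-- item stmt-NavierStokesRegularity-18152 · support · rank 9 · closed · proved by Summit.NavierStokesRegularity.NavierStokesRegularity.Theorems.levelSetModeration_moderationIdentity_proof @ 25716ac17d3e (prover) · by planner
sources: TranYu2016, TranYuDritschel2021
[support] for a C¹ divergence-free field with bounded super-level set {|u|>c} and continuous g: ∫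
1_{|u|>c} g(|u|) (c/|u|²) (u·∇|u|) dx = 0 (= ∫ u·∇G(|u|)); hence any Φ(t,|u|) can be subtracted from
p̃ in the pressure-work pairing (Tran–Yu moderation in De Giorgi form). [difficulty: provable-now] -/
@[route_item "route-NavierStokesRegularity-LevelSetModeration"]
def ModerationIdentity : Prop :=
  ∀ (u : EuclideanSpace ℝ (Fin 3) → EuclideanSpace ℝ (Fin 3)) (g : ℝ → ℝ) (c : ℝ), 0 < c → ContDiff ℝ 1 u → Literature.Analysis.FluidPDE.VectorCalculus.IsDivFree u → Continuous g → Bornology.IsBounded {x | c < ‖u x‖} → ∫ x, Set.indicator {x | c < ‖u x‖} (fun x => g ‖u x‖ * (c / ‖u x‖ ^ 2) * fderiv ℝ (fun y => ‖u y‖) x (u x)) x = 0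

/-- item stmt-NavierStokesRegularity-18153 · support · rank 9 · closed · proved by Summit.NavierStokesRegularity.NavierStokesRegularity.Theorems.iterationLemma_proof @ 2e326ad4f0ad (prover) · by planner
sources: Vasseur2007
[support] Vasseur's nonlinear iteration lemma with explicit threshold: 0 ≤ W_{k+1} ≤ C^{k+1} W_k^β,
C > 1, β > 1, W_0 ≤ C^{−β/(β−1)²} ⇒ W_k → 0 (PROVED sorry-free in the planner folder,
bc/IterationLemma_special.lean, rc 0). [difficulty: provable-now] -/
@[route_item "route-NavierStokesRegularity-LevelSetModeration"]
def IterationLemma : Prop :=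
  ∀ (C β : ℝ), 1 < C → 1 < β → ∀ (W : ℕ → ℝ), (∀ k, 0 ≤ W k) → (∀ k, W (k + 1) ≤ C ^ (k + 1) * (W k) ^ β) → W 0 ≤ C ^ (-(β / (β - 1) ^ 2)) → Filter.Tendsto W Filter.atTop (nhds 0)

/-- item stmt-NavierStokesRegularity-18539 · support (kind.auto-crux: conjecture-grade) · rank 9 · closed · proved by Summit.NavierStokesRegularity.NavierStokesRegularity.Theorems.levelSetModeration_boundedToClay_proof @ 0318aa8792c0 (prover) · by planner
why it might fail: not a crux — known result, PROVED in tree (RobinsonRodrigoSadowski2016 Thm 8.17 = hasSmoothExtensionPast_of_bounded_holds, composed with stmt-0055 = typeICertificateLadder_noBlowupToClay_proof; composite kernel-checked in bc/BoundedToClay_provable.lean); kept unclaimed only for import-cone hygiene.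
sources: RobinsonRodrigoSadowski2016, Leray1934, Fefferman2000, KNSS2009
[support] BOUNDED ⇒ CLAY (A), NoBlowup form (cone repair 2026-08-17; replaces the direct use of two
landed theorems in `closes`): if every classical solution of unforced NS on ℝ³×[0,T) that is
Leray–Hopf on [0,T] from a rapidly decaying datum is bounded on [0,T)×ℝ³ (all ν, T > 0), then
Fefferman's (A) holds — bounded continuation (RobinsonRodrigoSadowski2016 Thm 8.17, Prodi–Serrin
class L²_t L^∞_x; Leray 1934) + the shared local Clay theory NoBlowup → (A) (stmt-0055). PROVED IN
TREE: `fun h => typeICertificateLadder_noBlowupToClay_proof (fun ν T hν hT u p hcl hLH hdec =>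
hasSmoothExtensionPast_of_bounded_holds hν hT hcl hLH (h ν T hν hT u p hcl hLH hdec))` (planner
folder bc/BoundedToClay_provable.lean, rc 0, standard axioms). CONE HYGIENE: those theorems sit in
modules whose import closure carries 26 unproved named facts (open problems among them:
TypeISingularityExists, LerayHopfNonUniqueness, RusinSverakQuestion, chen_hou_blowup); closing this
item by importing Theorems.TypeICertificateLadderNoBlowupToClay / KNSSTypeIIHolds re-imports them
here through the `_holds` link and re-blocks the route for provers. It is certain — leave it OPEN
until HighSpeedPressureWork / LevelSetClosu -/
@[route_item "route-NavierStokesRegularity-LevelSetModeration", crux]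
def BoundedToClay : Prop :=
  (∀ (ν T : ℝ), 0 < ν → 0 < T → ∀ (u : ℝ → EuclideanSpace ℝ (Fin 3) → EuclideanSpace ℝ (Fin 3)) (p : ℝ → EuclideanSpace ℝ (Fin 3) → ℝ), Literature.Analysis.FluidPDE.IsClassicalNSSolutionOn (Set.Ico 0 T) ν 0 u p → Literature.Analysis.FluidPDE.IsLerayHopfOn T ν 0 (u 0) u → Literature.Analysis.FluidPDE.HasRapidSpatialDecay (u 0) → ∃ B : ℝ, ∀ t ∈ Set.Ico 0 T, ∀ x, ‖u t x‖ ≤ B) → NavierStokesRegularity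

-- earlier Assembly (stmt-NavierStokesRegularity-18154, replaced 2026-08-17T02:42:45Z -> stmt-NavierStokesRegularity-18538): retired by None — HighSpeedPressureWork → LevelSetClosure → _root_.NavierStokesRegularity
/-- item stmt-NavierStokesRegularity-18538 · assembly · rank 1 · closed · proved by Summit.NavierStokesRegularity.NavierStokesRegularity.Theorems.levelSetModeration_assembly_proof @ 329419f48496 (prover) · by planner
sources: Vasseur2007, Fefferman2000
[assembly] HighSpeedPressureWork → LevelSetClosure → BoundedToClay → NavierStokesRegularity (mirrors
the certified cone-clean `closes`; provable by `fun h₁ h₂ h₃ => closes h₁ h₂ h₃`, pure logic, no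
Theorems import needed beyond this file). -/
@[route_item "route-NavierStokesRegularity-LevelSetModeration"]
def Assembly : Prop :=
  HighSpeedPressureWork → LevelSetClosure → BoundedToClay → _root_.NavierStokesRegularity

/-! D-0027 §2.1 — DECIDING THEOREM (planner-authored via `route open/edit --closes-file`; by planner-rrepair-NavierStokesRegularity-LevelSe-cd1791d8-0 2026-08-17T02:42:45Z):
its hypotheses are this route's items and its conclusion the sub-problem Statement (glue_lint), and it elaborates with this file. -/

@[closes "route-NavierStokesRegularity-LevelSetModeration"] theorem closes (h₁ : HighSpeedPressureWork) (h₂ : LevelSetClosure) (h₃ : BoundedToClay) :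
    _root_.NavierStokesRegularity := by
  -- pure logic, cone-clean (no Theorems / proof-module import): cruxes 2+3 bound every classical
  -- Leray–Hopf solution from a rapidly decaying datum on [0,T); BoundedToClay turns that into Clay (A).
  refine h₃ ?_
  intro ν T hν hT u p hcl hLH hdec
  obtain ⟨m, hm, F, hF⟩ := h₁ ν T hν hT
  obtain ⟨C₀, hC₀⟩ := hdec 0 0
  have hB : ∀ x, ‖u 0 x‖ ≤ C₀ := fun x => by
    have h := hC₀ x
    rwa [pow_zero, one_mul, norm_iteratedFDeriv_zero] at h
  have hB' : ∀ x, ‖u 0 x‖ ≤ (2 * C₀ + 2) / 2 := fun x => by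
    have := hB x; linarith
  have hW := hF u p hcl hLH hdec (∫ x, ‖u 0 x‖ ^ 2) C₀ le_rfl hB
  exact h₂ ν T hν hT u p hcl hLH hdec m (F (∫ x, ‖u 0 x‖ ^ 2) C₀) (2 * C₀ + 2)
    hm (by have := le_trans (norm_nonneg _) (hB 0); linarith) hB'
    (fun M c t hM hc hcM hc0 ht => hW M c t (by linarith) hc hcM hc0 ht)

end Summit.NavierStokesRegularity.NavierStokesRegularity.Theses.LevelSetModeration
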